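import Literature.AlgebraicGeometry.Frobenioids.PadicFrobenioidPairIsoOrientation
import HarnessLib

/-!
# Frobenioids II, Thm. 2.4 (ii): the pair `G₁ ⥲ G₂`, `ℚ̄_{p₁}^× ⥲ ℚ̄_{p₂}^×` with EVERY witness of ONE run exposed —
# straightening kept, orientation and [AbsAnab] chart for GIVEN witnesses

Mochizuki, *The geometry of Frobenioids II*, Kyushu J. Math. **62** (2008) 401–460, §2, proof of Thm. 2.4 (ii), p. 20 l.−5 –
p. 21 l. 6 [cite: MochizukiFrdII2008, Thm 2.4 (ii) p.21]: "by varying the objects `Aᵢ` and reconstructing the multiplicative group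
associated to the field determined by the image of `Aᵢ` … as the groupification of the monoid `O^▷(Aᵢ)` … `Ψ` induces a pair of
compatible isomorphisms `G₁ ⥲ G₂`; `K̄₁^× ⥲ K̄₂^×` … we may apply [[AbsAnab], Prop. 1.2.1]".

PROOF-ONLY companion (cell abc-iut, node FrdII:Thm2.4(ii), junction «T24ii-J2» piece P4; seat abc-iut-L1-t7 gen 8) of
abc-iut-w5-d229's `PadicFrobenioidPairIsoLevelwise` / `PadicFrobenioidPairIsoOrientation`.  Those files export the pair at the
genuine §2 bases through three successive existentials — `exists_pairIso_fbarUnits_levelwise` (which DISCARDS the straightening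
clause "`r_{φ g} = ι⁻¹ ≫ E(r_g) ≫ ι`" of `exists_pairIso_topological_levelwise`), `exists_pairIso_fbarUnits_integral` and
`exists_pairIso_absAnabChart_unitsTransport` (each of which re-derives its own witnesses) — so that the straightening `ι`, the
levelwise formula for `e`, the orientation of `ψ̄` and the chart pair `(α, ψ̄♮)` are never simultaneously in scope.  The
Frobenioid-side junction of Thm. 2.4 (ii) (the square "`Ψ` on `μ_N(A₁) ⊆ O^▷(A₁)` IS `ψ̄♮`" for the context isomorphism whose `θ`
is THIS `φ`) needs them together.  This file re-runs the three steps keeping everything: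
* §1 `exists_pairIso_fbarUnits_straightened` — `exists_pairIso_fbarUnits_levelwise` VERBATIM plus the straightening clause
  `∀ g, toAutCoset N₂ (φ g) = ι.conjAut (E^op (toAutCoset N g))` (the input of "`Ψ_Base = φ_*` naturally");
* §2 `norm_psibar_le_one_of_levelwise` — the orientation "`‖a‖ ≤ 1 ⇒ ‖ψ̄(a)‖ ≤ 1`" for GIVEN witnesses
  (`ι, e, x₁, x₂, ι₁, ι₂, ψ̄` with the levelwise formula, the legs `a ↦ x_{i,k}⁻¹·a` and `ψ̄ = ι₂ ∘ e ∘ ι₁⁻¹`) under `hpos`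
  ("`Ψ_B` preserves effective divisors", [FrdI] Cor. 4.11; proved for equivalences by abc-iut-L1-d3's `hpos_of_equivalence`) —
  steps (1)–(5) of `exists_pairIso_fbarUnits_integral` with its `obtain`s turned into binders;
* §3 `exists_absAnabChart_of_integral` — from a compatible pair `(ψ, ψ̄)` with integral `ψ̄` ALONE: the chart pair
  `(α, ψ̄♮)` with `ψ̄♮` `α`-equivariant, `𝒪^×`-preserving AND uniformiser-preserving (§4 of `PadicFrobenioidPairIsoOrientation`
  with its first `obtain` turned into binders).
Theorems only (no definitions); classical bookkeeping over landed files; nothing here bears on [IUTchIII] Cor. 3.12.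
-/

noncomputable section

namespace Literature.AlgebraicGeometry.Frobenioids

open CategoryTheory CategoryTheory.Limits Opposite Topology Filter Function ValuativeRel
open Literature.AnabelianGeometry.SemiGraphs
open scoped ValuativeRel

namespace BaseGaloisSystem

open QuasiTemperoid

/-! ### §1 The pair at the genuine bases WITH the straightening clause -/

section Straightened

variable {p₁ p₂ : ℕ} [Fact p₁.Prime] [Fact p₂.Prime]
  {G : Type} [Group G] [TopologicalSpace G] [IsTopologicalGroup G] (hG : IsTempered G)
  {G₂ : Type} [Group G₂] [TopologicalSpace G₂] [IsTopologicalGroup G₂] (hG₂ : IsTempered G₂)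
  (φ₁ : G →* GalFbar ℚ_[p₁]) (hφ₁ : IsOpenHom φ₁) (φ₂ : G₂ →* GalFbar ℚ_[p₂]) (hφ₂ : IsOpenHom φ₂)
  (N : ℕ → OpenNormalSubgroup G) (hN : Antitone N)
  (d₁ : PadicFrd.Datum (CosetCat G) p₁) (d₂ : PadicFrd.Datum (CosetCat G₂) p₂)

include hG hG₂ in
/-- **[FrdII] Thm. 2.4 (ii): the printed pair ON THE ALGEBRAIC CLOSURES, every identification exposed, STRAIGHTENING KEPT.**
Exactly abc-iut-w5-d229's `exists_pairIso_fbarUnits_levelwise` — over the genuine §2 bases and for chosen base-point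
representatives `x_{1,k}`: `φ : Π₁ ≃ₜ* Π₂` over its descent `ψ : G₁ ≃ₜ* G₂`, a cofinal tower `N₂` with `φ(N_k) = N₂,k`, the
straightening `ι`, the `φ`-equivariant `e` given levelwise by "`toB0₂ ∘ Ψ_B ∘ toB0₁⁻¹` then `B₀(ι_k)`", the identifications
`ιᵢ : lim→ ⥲ ℚ̄_{pᵢ}^×` with legs `a ↦ x_{i,k}⁻¹·a`, and `ψ̄ = ι₂ ∘ e ∘ ι₁⁻¹` compatible with `ψ` — PLUS the clause that file drops:
the straightening `ι` READS OFF `φ` on the Galois pro-system, `r_{φ g} = ι⁻¹ ≫ E(r_g) ≫ ι` (as automorphisms of `(Π₂/N₂,k)_k`),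
which is what makes `E = Ψ_Base` NATURALLY isomorphic to `φ_*`. [cite: MochizukiFrdII2008, Thm 2.4 (ii) p.21] -/
theorem exists_pairIso_fbarUnits_straightened
    (hd₁ : d₁.base = CosetCat.push φ₁ hφ₁.isOpenMap ⋙ CosetCat.toConnected (isTempered_galFbar ℚ_[p₁]) ⋙
      galoisPadicFields p₁)
    (hd₂ : d₂.base = CosetCat.push φ₂ hφ₂.isOpenMap ⋙ CosetCat.toConnected (isTempered_galFbar ℚ_[p₂]) ⋙
      galoisPadicFields p₂)
    (hfs₁ : d₁.IsFieldwiseSaturated) (hfs₂ : d₂.IsFieldwiseSaturated)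
    (E : CosetCat G ≌ CosetCat G₂) (ΨB : d₁.B ≅ E.functor.op ⋙ d₂.B)
    (hNb : ∀ U ∈ 𝓝 (1 : G), ∃ k, (N k : Set G) ⊆ U)
    (x₁ : ℕ → GalFbar ℚ_[p₁])
    (hx₁ : ∀ k, (x₁ k : ((CosetCat.push φ₁ hφ₁.isOpenMap).obj (cQ (N k))).carrier) =
      (basePt ((CosetCat.toConnected (isTempered_galFbar ℚ_[p₁])).obj ((CosetCat.push φ₁ hφ₁.isOpenMap).obj (cQ (N k)))) :
        ((CosetCat.push φ₁ hφ₁.isOpenMap).obj (cQ (N k))).carrier)) :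
    haveI := hasColimitsOfShape_nat_commMonCat.{0}
    ∃ (φ : G ≃ₜ* G₂) (ψ : φ₁.range ≃ₜ* φ₂.range) (N₂ : ℕ → OpenNormalSubgroup G₂) (hN₂ : Antitone N₂)
      (_ : ∀ U ∈ 𝓝 (1 : G₂), ∃ k, (N₂ k : Set G₂) ⊆ U) (_ : ∀ (k : ℕ) (g : G), g ∈ N k ↔ φ g ∈ N₂ k)
      (ι : cosetSystem N hN ⋙ E.functor.op ≅ cosetSystem N₂ hN₂)
      (e : colimit (cosetSystem N hN ⋙ PadicFrd.bZeroOn d₁.base) ≅ colimit (cosetSystem N₂ hN₂ ⋙ PadicFrd.bZeroOn d₂.base))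
      (x₂ : ℕ → GalFbar ℚ_[p₂])
      (_ : ∀ k, (x₂ k : ((CosetCat.push φ₂ hφ₂.isOpenMap).obj (cQ (N₂ k))).carrier) =
        (basePt ((CosetCat.toConnected (isTempered_galFbar ℚ_[p₂])).obj ((CosetCat.push φ₂ hφ₂.isOpenMap).obj (cQ (N₂ k)))) :
          ((CosetCat.push φ₂ hφ₂.isOpenMap).obj (cQ (N₂ k))).carrier))
      (ι₁ : colimit (cosetSystem N hN ⋙ PadicFrd.bZeroOn d₁.base) ≅ CommMonCat.of (Fbar ℚ_[p₁])ˣ)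
      (ι₂ : colimit (cosetSystem N₂ hN₂ ⋙ PadicFrd.bZeroOn d₂.base) ≅ CommMonCat.of (Fbar ℚ_[p₂])ˣ)
      (ψbar : (Fbar ℚ_[p₁])ˣ ≃* (Fbar ℚ_[p₂])ˣ),
      -- `φ` over `ψ`
      φ₁.ker.map φ.toMulEquiv.toMonoidHom = φ₂.ker ∧
      (∀ g : G, (ψ ⟨φ₁ g, ⟨g, rfl⟩⟩ : GalFbar ℚ_[p₂]) = φ₂ (φ g)) ∧
      -- the straightening reads off `φ`
      (∀ g : G, toAutCoset N₂ hN₂ (φ g) =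
        ι.conjAut ((Equivalence.congrRight (E := ℕ) E.op).functor.mapIso (toAutCoset N hN g))) ∧
      -- `e` equivariant and LEVELWISE
      (∀ g : G, e.hom ≫ colimMap (Functor.whiskerRight (toAutCoset N₂ hN₂ (φ g)).hom (PadicFrd.bZeroOn d₂.base)) =
        colimMap (Functor.whiskerRight (toAutCoset N hN g).hom (PadicFrd.bZeroOn d₁.base)) ≫ e.hom) ∧
      (∀ (k : ℕ) (b : d₁.B.obj (op (cQ (N k)))),
        e.hom (colimit.ι (cosetSystem N hN ⋙ PadicFrd.bZeroOn d₁.base) k (d₁.toB0.app (op (cQ (N k))) b)) =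
          colimit.ι (cosetSystem N₂ hN₂ ⋙ PadicFrd.bZeroOn d₂.base) k
            ((PadicFrd.bZeroOn d₂.base).map (ι.hom.app k)
              (d₂.toB0.app (op (E.functor.obj (cQ (N k)))) (ΨB.hom.app (op (cQ (N k))) b)))) ∧
      -- the identifications `lim→ = ℚ̄^×`: legs `a ↦ x_k⁻¹ · a`
      (∀ (k : ℕ) (u : (cosetSystem N hN ⋙ PadicFrd.bZeroOn d₁.base).obj k),
        ((ι₁.hom (colimit.ι (cosetSystem N hN ⋙ PadicFrd.bZeroOn d₁.base) k u) : (Fbar ℚ_[p₁])ˣ) : Fbar ℚ_[p₁]) =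
          (x₁ k)⁻¹ ((show ↥(fixFld ℚ_[p₁] ((CosetCat.toConnected (isTempered_galFbar ℚ_[p₁])).obj
              ((CosetCat.push φ₁ hφ₁.isOpenMap).obj (cQ (N k))))) from
            ((eqToHom (congrArg (fun b : CosetCat G ⥤ PadicFrd.PadicFld.{0} p₁ => b.obj (cQ (N k))) hd₁).symm).alg
              (show ((cosetSystem N hN ⋙ PadicFrd.bZeroOn d₁.base).obj k) from u).val)) : Fbar ℚ_[p₁])) ∧
      (∀ (k : ℕ) (u : (cosetSystem N₂ hN₂ ⋙ PadicFrd.bZeroOn d₂.base).obj k),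
        ((ι₂.hom (colimit.ι (cosetSystem N₂ hN₂ ⋙ PadicFrd.bZeroOn d₂.base) k u) : (Fbar ℚ_[p₂])ˣ) : Fbar ℚ_[p₂]) =
          (x₂ k)⁻¹ ((show ↥(fixFld ℚ_[p₂] ((CosetCat.toConnected (isTempered_galFbar ℚ_[p₂])).obj
              ((CosetCat.push φ₂ hφ₂.isOpenMap).obj (cQ (N₂ k))))) from
            ((eqToHom (congrArg (fun b : CosetCat G₂ ⥤ PadicFrd.PadicFld.{0} p₂ => b.obj (cQ (N₂ k))) hd₂).symm).alg
              (show ((cosetSystem N₂ hN₂ ⋙ PadicFrd.bZeroOn d₂.base).obj k) from u).val)) : Fbar ℚ_[p₂])) ∧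
      -- `ψ̄ = ι₂ ∘ e ∘ ι₁⁻¹`, compatible with `ψ`
      (∀ z, ψbar (ι₁.hom z) = ι₂.hom (e.hom z)) ∧
      (∀ (g : G) (u : (Fbar ℚ_[p₁])ˣ),
        ψbar (Units.map ((φ₁ g : GalFbar ℚ_[p₁]) : Fbar ℚ_[p₁] →* Fbar ℚ_[p₁]) u) =
          Units.map ((φ₂ (φ g) : GalFbar ℚ_[p₂]) : Fbar ℚ_[p₂] →* Fbar ℚ_[p₂]) (ψbar u)) ∧
      ∀ (σ : φ₁.range) (u : (Fbar ℚ_[p₁])ˣ),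
        ψbar (Units.map ((σ : GalFbar ℚ_[p₁]) : Fbar ℚ_[p₁] →* Fbar ℚ_[p₁]) u) =
          Units.map (((ψ σ : φ₂.range) : GalFbar ℚ_[p₂]) : Fbar ℚ_[p₂] →* Fbar ℚ_[p₂]) (ψbar u) := by
  haveI := hasColimitsOfShape_nat_commMonCat.{0}
  obtain ⟨base₁, hloc₁, hc₁, he₁, Φ₁, j₁, hj₁, hmono₁, B₁, toB0₁, divB₁, sq₁, cart₁, nz₁⟩ := d₁
  obtain ⟨base₂, hloc₂, hc₂, he₂, Φ₂, j₂, hj₂, hmono₂, B₂, toB0₂, divB₂, sq₂, cart₂, nz₂⟩ := d₂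
  cases hd₁
  cases hd₂
  obtain ⟨φ, N₂, hN₂, hN₂b, hlev, ι, e, hstr, he, hlw⟩ :=
    exists_pairIso_topological_levelwise hG hG₂ N hN _ _ hfs₁ hfs₂ E ΨB hNb
  obtain ⟨x₂, hx₂⟩ := exists_rep_basePt_seq φ₂ hφ₂ N₂
  obtain ⟨hker, ψ₀, hψ₀⟩ :=
    exists_rangeEquiv_of_equivariant φ₁ hφ₁ φ₂ hφ₂ N hN N₂ hN₂ hNb hN₂b φ.toMulEquiv e he
  obtain ⟨ψ, hψ⟩ := exists_continuousMulEquiv_range φ₁ φ₂ hφ₁.continuous hφ₁.isOpenMap hφ₂.continuous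
    hφ₂.isOpenMap φ ψ₀ hψ₀
  obtain ⟨ι₁, ι₂, ψbar, hleg₁, hleg₂, hfac, hψbar⟩ :=
    exists_fbarUnitsEquiv_of_equivariant_rep φ₁ hφ₁ φ₂ hφ₂ N hN N₂ hN₂ hNb hN₂b x₁ hx₁ x₂ hx₂ φ e he
  refine ⟨φ, ψ, N₂, hN₂, hN₂b, hlev, ι, e, x₂, hx₂, ι₁, ι₂, ψbar, hker, fun g => by rw [hψ]; exact hψ₀ g, hstr, he, hlw,
    hleg₁, hleg₂, hfac, hψbar, fun σ u => ?_⟩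
  obtain ⟨_, g, rfl⟩ := σ
  rw [hψbar g u, hψ]
  exact (congrArg (fun s : GalFbar ℚ_[p₂] => Units.map (s : Fbar ℚ_[p₂] →* Fbar ℚ_[p₂]) (ψbar u)) (hψ₀ g)).symm

end Straightened

/-! ### §2 The orientation of `ψ̄` for GIVEN witnesses: `‖a‖ ≤ 1 ⇒ ‖ψ̄(a)‖ ≤ 1` -/

section Orientation

variable {p₁ p₂ : ℕ} [Fact p₁.Prime] [Fact p₂.Prime]
  {G : Type} [Group G] [TopologicalSpace G]
  {G₂ : Type} [Group G₂] [TopologicalSpace G₂]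
  (φ₁ : G →* GalFbar ℚ_[p₁]) (hφ₁ : IsOpenHom φ₁) (φ₂ : G₂ →* GalFbar ℚ_[p₂]) (hφ₂ : IsOpenHom φ₂)
  (N : ℕ → OpenNormalSubgroup G) (hN : Antitone N)
  (d₁ : PadicFrd.Datum (CosetCat G) p₁) (d₂ : PadicFrd.Datum (CosetCat G₂) p₂)

/-- **Orientation for GIVEN witnesses ([FrdII] Thm. 2.4 (ii) with the input of [FrdI] Cor. 4.11, "`Ψ` preserves `O^▷(−)`").**
For fieldwise saturated `p₁`-adic data over the genuine §2 base, the row-L02 slot `Ψ_B : B₁ ≅ E^op ⋙ B₂` carrying elements with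
EFFECTIVE divisor to elements with effective divisor (`hpos`), and ANY witnesses of the levelwise description of the pair —
a straightening `ι : (Π₁/N_k)_k ⋙ E ≅ (Π₂/N₂,k)_k`, an `e : lim→ K_{1,Π₁/N_k}^× ≅ lim→ K_{2,Π₂/N₂,k}^×` satisfying the levelwise
formula `e [toB0₁ b]_k = [B₀(ι_k)(toB0₂ (Ψ_B b))]_k`, identifications `ιᵢ : lim→ ⥲ ℚ̄_{pᵢ}^×` with legs `a ↦ x_{i,k}⁻¹·a` through
Galois elements `x_{i,k}`, and `ψ̄ = ι₂ ∘ e ∘ ι₁⁻¹` — the isomorphism `ψ̄ : ℚ̄_{p₁}^× ⥲ ℚ̄_{p₂}^×` carries `p₁`-ADIC INTEGERS to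
`p₂`-ADIC INTEGERS.  Proof (abc-iut-w5-d229's, steps (1)–(5)): an integral `a` is `x_{1,k}⁻¹ · toB0₁(b)` for `k ≫ 0` with
`Div_B(b)` effective, so `Div_B(Ψ_B b)` is effective, `toB0₂(Ψ_B b)` integral, and `ψ̄(a) = x_{2,k}⁻¹ · B₀(ι_k)(toB0₂(Ψ_B b))`,
Galois elements being isometries. [cite: MochizukiFrdII2008, Thm 2.4 (ii) p.21] -/
theorem norm_psibar_le_one_of_levelwise
    (hd₁ : d₁.base = CosetCat.push φ₁ hφ₁.isOpenMap ⋙ CosetCat.toConnected (isTempered_galFbar ℚ_[p₁]) ⋙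
      galoisPadicFields p₁)
    (hd₂ : d₂.base = CosetCat.push φ₂ hφ₂.isOpenMap ⋙ CosetCat.toConnected (isTempered_galFbar ℚ_[p₂]) ⋙
      galoisPadicFields p₂)
    (hfs₁ : d₁.IsFieldwiseSaturated)
    (E : CosetCat G ≌ CosetCat G₂) (ΨB : d₁.B ≅ E.functor.op ⋙ d₂.B)
    (hNb : ∀ U ∈ 𝓝 (1 : G), ∃ k, (N k : Set G) ⊆ U)
    (hpos : ∀ (k : ℕ) (b : d₁.B.obj (op (cQ (N k)))) (c : d₁.Φ.obj (op (cQ (N k)))),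
      Frobenioids.divB d₁.Φ d₁.B d₁.divB (op (cQ (N k))) b = Algebra.GrothendieckGroup.of c →
      ∃ c₂ : d₂.Φ.obj (op (E.functor.obj (cQ (N k)))),
        Frobenioids.divB d₂.Φ d₂.B d₂.divB (op (E.functor.obj (cQ (N k)))) (ΨB.hom.app (op (cQ (N k))) b) =
          Algebra.GrothendieckGroup.of c₂)
    (N₂ : ℕ → OpenNormalSubgroup G₂) (hN₂ : Antitone N₂)
    (ι : cosetSystem N hN ⋙ E.functor.op ≅ cosetSystem N₂ hN₂)
    [HasColimit (cosetSystem N hN ⋙ PadicFrd.bZeroOn d₁.base)]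
    [HasColimit (cosetSystem N₂ hN₂ ⋙ PadicFrd.bZeroOn d₂.base)]
    (e : colimit (cosetSystem N hN ⋙ PadicFrd.bZeroOn d₁.base) ≅ colimit (cosetSystem N₂ hN₂ ⋙ PadicFrd.bZeroOn d₂.base))
    (x₁ : ℕ → GalFbar ℚ_[p₁]) (x₂ : ℕ → GalFbar ℚ_[p₂])
    (ι₁ : colimit (cosetSystem N hN ⋙ PadicFrd.bZeroOn d₁.base) ≅ CommMonCat.of (Fbar ℚ_[p₁])ˣ)
    (ι₂ : colimit (cosetSystem N₂ hN₂ ⋙ PadicFrd.bZeroOn d₂.base) ≅ CommMonCat.of (Fbar ℚ_[p₂])ˣ)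
    (ψbar : (Fbar ℚ_[p₁])ˣ ≃* (Fbar ℚ_[p₂])ˣ)
    (hlw : ∀ (k : ℕ) (b : d₁.B.obj (op (cQ (N k)))),
      e.hom (colimit.ι (cosetSystem N hN ⋙ PadicFrd.bZeroOn d₁.base) k (d₁.toB0.app (op (cQ (N k))) b)) =
        colimit.ι (cosetSystem N₂ hN₂ ⋙ PadicFrd.bZeroOn d₂.base) k
          ((PadicFrd.bZeroOn d₂.base).map (ι.hom.app k)
            (d₂.toB0.app (op (E.functor.obj (cQ (N k)))) (ΨB.hom.app (op (cQ (N k))) b))))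
    (hleg₁ : ∀ (k : ℕ) (u : (cosetSystem N hN ⋙ PadicFrd.bZeroOn d₁.base).obj k),
      ((ι₁.hom (colimit.ι (cosetSystem N hN ⋙ PadicFrd.bZeroOn d₁.base) k u) : (Fbar ℚ_[p₁])ˣ) : Fbar ℚ_[p₁]) =
        (x₁ k)⁻¹ ((show ↥(fixFld ℚ_[p₁] ((CosetCat.toConnected (isTempered_galFbar ℚ_[p₁])).obj
            ((CosetCat.push φ₁ hφ₁.isOpenMap).obj (cQ (N k))))) from
          ((eqToHom (congrArg (fun b : CosetCat G ⥤ PadicFrd.PadicFld.{0} p₁ => b.obj (cQ (N k))) hd₁).symm).alg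
            (show ((cosetSystem N hN ⋙ PadicFrd.bZeroOn d₁.base).obj k) from u).val)) : Fbar ℚ_[p₁]))
    (hleg₂ : ∀ (k : ℕ) (u : (cosetSystem N₂ hN₂ ⋙ PadicFrd.bZeroOn d₂.base).obj k),
      ((ι₂.hom (colimit.ι (cosetSystem N₂ hN₂ ⋙ PadicFrd.bZeroOn d₂.base) k u) : (Fbar ℚ_[p₂])ˣ) : Fbar ℚ_[p₂]) =
        (x₂ k)⁻¹ ((show ↥(fixFld ℚ_[p₂] ((CosetCat.toConnected (isTempered_galFbar ℚ_[p₂])).obj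
            ((CosetCat.push φ₂ hφ₂.isOpenMap).obj (cQ (N₂ k))))) from
          ((eqToHom (congrArg (fun b : CosetCat G₂ ⥤ PadicFrd.PadicFld.{0} p₂ => b.obj (cQ (N₂ k))) hd₂).symm).alg
            (show ((cosetSystem N₂ hN₂ ⋙ PadicFrd.bZeroOn d₂.base).obj k) from u).val)) : Fbar ℚ_[p₂]))
    (hfac : ∀ z, ψbar (ι₁.hom z) = ι₂.hom (e.hom z))
    (u : (Fbar ℚ_[p₁])ˣ) (hu : ‖(show PadicAlgCl p₁ from (u : Fbar ℚ_[p₁]))‖ ≤ 1) :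
    ‖(show PadicAlgCl p₂ from ((ψbar u : (Fbar ℚ_[p₂])ˣ) : Fbar ℚ_[p₂]))‖ ≤ 1 := by
  haveI := hasColimitsOfShape_nat_commMonCat.{0}
  obtain ⟨base₁, hloc₁, hc₁, he₁, Φ₁, j₁, hj₁, hmono₁, B₁, toB0₁, divB₁, sq₁, cart₁, nz₁⟩ := d₁
  obtain ⟨base₂, hloc₂, hc₂, he₂, Φ₂, j₂, hj₂, hmono₂, B₂, toB0₂, divB₂, sq₂, cart₂, nz₂⟩ := d₂
  cases hd₁
  cases hd₂
  -- (the two data are now literal structures over the genuine bases; the `Datum` arguments below are inferred from them)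
  -- (1) `a = u` lies, with its orbit, in `K_{1,k}` for `k ≫ 0`; `w := x_{1,k}·a ∈ K_{1,k}`, integral
  obtain ⟨k, hk⟩ := exists_orbit_mem_fixFld_genuine φ₁ hφ₁ N hNb (u : Fbar ℚ_[p₁])
  let K₁ : IntermediateField ℚ_[p₁] (Fbar ℚ_[p₁]) :=
    fixFld ℚ_[p₁] ((CosetCat.toConnected (isTempered_galFbar ℚ_[p₁])).obj ((CosetCat.push φ₁ hφ₁.isOpenMap).obj (cQ (N k))))
  have hw0 : (⟨x₁ k (u : Fbar ℚ_[p₁]), hk (x₁ k)⟩ : K₁) ≠ 0 := fun h =>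
    u.ne_zero ((map_eq_zero_iff _ (x₁ k).injective).mp (congrArg Subtype.val h))
  let W : K₁ˣ := Units.mk0 _ hw0
  have hWval : ((W : K₁) : Fbar ℚ_[p₁]) = x₁ k (u : Fbar ℚ_[p₁]) := rfl
  have hWint : letI := subfieldValuativeRel p₁ K₁; valuation K₁ (W : K₁) ≤ 1 := by
    refine (valuation_le_one_iff_norm_le_one p₁ K₁ (W : K₁)).mpr ?_
    rw [hWval]
    exact (norm_galFbar_apply p₁ (x₁ k) (u : Fbar ℚ_[p₁])).le.trans hu
  -- (2) `W = toB0₁ b`, `Div_B(b)` effective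
  obtain ⟨b, hb⟩ := PadicFrd.Datum.toB0_surjective_of_isFieldwiseSaturated _ hfs₁ (op (cQ (N k))) W
  have hres : PadicFrd.Datum.resK _ (cQ (N k)) b = W := hb
  obtain ⟨c, hc⟩ :=
    PadicFrd.Datum.exists_divB_eq_of_of_valuation_le_one _ hfs₁ (cQ (N k)) b (by rw [hres]; exact hWint)
  -- (3) `Div_B(Ψ_B b)` effective, so `toB0₂ (Ψ_B b)` integral
  obtain ⟨c₂, hc₂⟩ := hpos k b c hc
  have hint₂ :=
    PadicFrd.Datum.valuation_resK_le_one_of_divB_eq_of _ (E.functor.obj (cQ (N k))) (ΨB.hom.app (op (cQ (N k))) b) c₂ hc₂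
  let K₂E : IntermediateField ℚ_[p₂] (Fbar ℚ_[p₂]) :=
    fixFld ℚ_[p₂] ((CosetCat.toConnected (isTempered_galFbar ℚ_[p₂])).obj
      ((CosetCat.push φ₂ hφ₂.isOpenMap).obj (E.functor.obj (cQ (N k)))))
  have hnorm₂ : ‖(((show K₂Eˣ from PadicFrd.Datum.resK _ (E.functor.obj (cQ (N k))) (ΨB.hom.app (op (cQ (N k))) b)) :
      K₂E) : PadicAlgCl p₂)‖ ≤ 1 :=
    (valuation_le_one_iff_norm_le_one p₂ K₂E _).mp hint₂
  -- (4) the field map of `ι_k` is a Galois element, an isometry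
  let K₂ : IntermediateField ℚ_[p₂] (Fbar ℚ_[p₂]) :=
    fixFld ℚ_[p₂] ((CosetCat.toConnected (isTempered_galFbar ℚ_[p₂])).obj ((CosetCat.push φ₂ hφ₂.isOpenMap).obj (cQ (N₂ k))))
  let z : K₂ˣ := (PadicFrd.bZeroOn _).map (ι.hom.app k)
    ((PadicFrd.Datum.toB0 _).app (op (E.functor.obj (cQ (N k)))) (ΨB.hom.app (op (cQ (N k))) b))
  have hzval : ((z : K₂) : Fbar ℚ_[p₂]) =
      carrier ((CosetCat.toConnected (isTempered_galFbar ℚ_[p₂])).map ((CosetCat.push φ₂ hφ₂.isOpenMap).map (ι.hom.app k).unop))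
        (((show K₂Eˣ from PadicFrd.Datum.resK _ (E.functor.obj (cQ (N k))) (ΨB.hom.app (op (cQ (N k))) b)) : K₂E) :
          Fbar ℚ_[p₂]) :=
    fieldMap_apply_of_ρ_eq _ (carrier_spec _) _
  have hznorm : ‖((z : K₂) : PadicAlgCl p₂)‖ ≤ 1 := by
    change ‖(show PadicAlgCl p₂ from ((z : K₂) : Fbar ℚ_[p₂]))‖ ≤ 1
    rw [hzval, norm_galFbar_apply]
    exact hnorm₂
  -- (5) `u = ι₁ [W]_k`, so `ψ̄ u = ι₂ (e [toB0₁ b]_k) = ι₂ [z]_k` has value `x_{2,k}⁻¹ · z`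
  have huW := (Units.ext ((hleg₁ k W).trans (show _ = (u : Fbar ℚ_[p₁]) by
    change (x₁ k)⁻¹ (x₁ k (u : Fbar ℚ_[p₁])) = (u : Fbar ℚ_[p₁])
    rw [← AlgEquiv.mul_apply, inv_mul_cancel, AlgEquiv.one_apply]))).symm
  have hψu : ((ψbar u : (Fbar ℚ_[p₂])ˣ) : Fbar ℚ_[p₂]) = (x₂ k)⁻¹ ((z : K₂) : Fbar ℚ_[p₂]) := by
    rw [huW, ← hb, hfac, hlw k b, hleg₂ k]
    rfl
  change ‖(show PadicAlgCl p₂ from ((ψbar u : (Fbar ℚ_[p₂])ˣ) : Fbar ℚ_[p₂]))‖ ≤ 1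
  rw [hψu, norm_galFbar_apply]
  exact hznorm

end Orientation

/-! ### §3 The [AbsAnab] chart for a GIVEN compatible pair with integral `ψ̄`: `ψ̄♮` IS the units transport -/

section Chart

open Literature.AnabelianGeometry.AbsoluteAnabelian Field

variable {p₁ p₂ : ℕ} [Fact p₁.Prime] [Fact p₂.Prime]
  {G : Type} [Group G] [TopologicalSpace G] {G₂ : Type} [Group G₂] [TopologicalSpace G₂]
  (φ₁ : G →* GalFbar ℚ_[p₁]) (hφ₁ : IsOpenHom φ₁) (φ₂ : G₂ →* GalFbar ℚ_[p₂]) (hφ₂ : IsOpenHom φ₂)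

/-- **The chart pair of a GIVEN compatible pair with integral `ψ̄` ([FrdII] Thm. 2.4 (ii), "we may apply [AbsAnab] Prop. 1.2.1").**
For ANY MLF structures on the base fields `Kᵢ = ℚ̄_{pᵢ}^{Gᵢ}` whose integers are the `pᵢ`-adic integers (`hv₁`, `hv₂`), a pair
(`ψ : G₁ ≃ₜ* G₂`, `ψ̄ : ℚ̄_{p₁}^× ⥲ ℚ̄_{p₂}^×`) with `ψ̄(σ·a) = ψ(σ)·ψ̄(a)` and `ψ̄` carrying `p₁`-adic integers to `p₂`-adic integers
(`hint`, the orientation of §2) has a chart reading — `α = galConjBase₂⁻¹ ∘ ψ ∘ galConjBase₁ : Gal(K̄₁/K₁) ≃ₜ* Gal(K̄₂/K₂)` and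
`ψ̄♮ = ι₂⁻¹ ∘ ψ̄ ∘ ι₁ : K̄₁^× ⥲ K̄₂^×` — in which `ψ̄♮` is `α`-equivariant, carries `𝒪^×_{K̄₁}` onto `𝒪^×_{K̄₂}`, AND carries
uniformisers of `K₁` to uniformisers of `K₂`: i.e. `ψ̄♮` IS the units transport of [AbsAnab] Prop. 1.2.1 (the inversion
alternative of `IsAlphaEquivariant.eq_or_eq_inv` would send a uniformiser to the inverse of a uniformiser, which is not
integral).  Proof = abc-iut-w5-d229's §4 of `PadicFrobenioidPairIsoOrientation`, for the given pair.
[cite: MochizukiFrdII2008, Thm 2.4 (ii) p.21] -/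
theorem exists_absAnabChart_of_integral
    [ValuativeRel (PadicFrd.RelGal.baseFld p₁ φ₁ hφ₁)] [TopologicalSpace (PadicFrd.RelGal.baseFld p₁ φ₁ hφ₁)]
    [IsNonarchimedeanLocalField (PadicFrd.RelGal.baseFld p₁ φ₁ hφ₁)]
    [ValuativeRel (PadicFrd.RelGal.baseFld p₂ φ₂ hφ₂)] [TopologicalSpace (PadicFrd.RelGal.baseFld p₂ φ₂ hφ₂)]
    [IsNonarchimedeanLocalField (PadicFrd.RelGal.baseFld p₂ φ₂ hφ₂)]
    (hv₁ : ∀ x : PadicFrd.RelGal.baseFld p₁ φ₁ hφ₁,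
      valuation (PadicFrd.RelGal.baseFld p₁ φ₁ hφ₁) x ≤ 1 ↔ ‖((x : Fbar ℚ_[p₁]) : PadicAlgCl p₁)‖ ≤ 1)
    (hv₂ : ∀ x : PadicFrd.RelGal.baseFld p₂ φ₂ hφ₂,
      valuation (PadicFrd.RelGal.baseFld p₂ φ₂ hφ₂) x ≤ 1 ↔ ‖((x : Fbar ℚ_[p₂]) : PadicAlgCl p₂)‖ ≤ 1)
    (ψ : φ₁.range ≃ₜ* φ₂.range) (ψbar : (Fbar ℚ_[p₁])ˣ ≃* (Fbar ℚ_[p₂])ˣ)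
    (hσ : ∀ (σ : φ₁.range) (u : (Fbar ℚ_[p₁])ˣ),
      ψbar (Units.map ((σ : GalFbar ℚ_[p₁]) : Fbar ℚ_[p₁] →* Fbar ℚ_[p₁]) u) =
        Units.map (((ψ σ : φ₂.range) : GalFbar ℚ_[p₂]) : Fbar ℚ_[p₂] →* Fbar ℚ_[p₂]) (ψbar u))
    (hint : ∀ u : (Fbar ℚ_[p₁])ˣ, ‖(show PadicAlgCl p₁ from (u : Fbar ℚ_[p₁]))‖ ≤ 1 →
      ‖(show PadicAlgCl p₂ from ((ψbar u : (Fbar ℚ_[p₂])ˣ) : Fbar ℚ_[p₂]))‖ ≤ 1) :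
    ∃ (α : absoluteGaloisGroup (PadicFrd.RelGal.baseFld p₁ φ₁ hφ₁) ≃ₜ* absoluteGaloisGroup (PadicFrd.RelGal.baseFld p₂ φ₂ hφ₂))
      (ψn : (AlgebraicClosure (PadicFrd.RelGal.baseFld p₁ φ₁ hφ₁))ˣ ≃* (AlgebraicClosure (PadicFrd.RelGal.baseFld p₂ φ₂ hφ₂))ˣ),
      (∀ τ : absoluteGaloisGroup (PadicFrd.RelGal.baseFld p₁ φ₁ hφ₁),
        ((PadicFrd.RelGal.galConjBase p₂ φ₂ hφ₂ (α τ) : ↥(PadicFrd.RelGal.baseFld p₂ φ₂ hφ₂).fixingSubgroup) :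
            GalFbar ℚ_[p₂]) =
          (ψ ⟨(PadicFrd.RelGal.galConjBase p₁ φ₁ hφ₁ τ : ↥(PadicFrd.RelGal.baseFld p₁ φ₁ hφ₁).fixingSubgroup),
            MonoidHom.mem_range.mpr ((PadicFrd.RelGal.mem_fixingSubgroup_baseFld_iff p₁ φ₁ hφ₁ _).mp
              (PadicFrd.RelGal.galConjBase p₁ φ₁ hφ₁ τ).2)⟩ : GalFbar ℚ_[p₂])) ∧
      (∀ y : (AlgebraicClosure (PadicFrd.RelGal.baseFld p₁ φ₁ hφ₁))ˣ,
        ((ψn y : (AlgebraicClosure (PadicFrd.RelGal.baseFld p₂ φ₂ hφ₂))ˣ) :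
            AlgebraicClosure (PadicFrd.RelGal.baseFld p₂ φ₂ hφ₂)) =
          (PadicFrd.RelGal.closureEquiv p₂ φ₂ hφ₂).symm
            ((ψbar (Units.map ((PadicFrd.RelGal.closureEquiv p₁ φ₁ hφ₁ :
              AlgebraicClosure (PadicFrd.RelGal.baseFld p₁ φ₁ hφ₁) ≃ₐ[PadicFrd.RelGal.baseFld p₁ φ₁ hφ₁] Fbar ℚ_[p₁]) :
                AlgebraicClosure (PadicFrd.RelGal.baseFld p₁ φ₁ hφ₁) →* Fbar ℚ_[p₁]) y) : (Fbar ℚ_[p₂])ˣ) :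
              Fbar ℚ_[p₂])) ∧
      Prop121vii.IsAlphaEquivariant α ψn ∧ Prop121vii.PreservesAbsUnits ψn ∧ Prop121vii.PreservesUniformizers ψn := by
  haveI : CharZero (PadicFrd.RelGal.baseFld p₁ φ₁ hφ₁) :=
    charZero_of_injective_algebraMap (algebraMap ℚ_[p₁] (PadicFrd.RelGal.baseFld p₁ φ₁ hφ₁)).injective
  haveI : CharZero (PadicFrd.RelGal.baseFld p₂ φ₂ hφ₂) :=
    charZero_of_injective_algebraMap (algebraMap ℚ_[p₂] (PadicFrd.RelGal.baseFld p₂ φ₂ hφ₂)).injective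
  obtain ⟨α, ψn, hα, hψn, heq⟩ := exists_isAlphaEquivariant_of_compatible φ₁ hφ₁ φ₂ hφ₂ ψ ψbar hσ
  obtain ⟨hu, ψ₀, ⟨hψ₀, hu₀, hπ₀⟩, halt⟩ := preservesAbsUnits_of_isAlphaEquivariant heq
  have hψn_eq : ψn = ψ₀ := by
    rcases halt with h | h
    · exact h
    · exfalso
      -- a uniformiser `π₁` of `K₁` and its image `π₂`, a uniformiser of `K₂`, under `ψ₀`
      obtain ⟨ϖ₁, hϖ₁⟩ := Valuation.exists_isUniformizer_of_isCyclic_of_nontrivial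
        (valuation (PadicFrd.RelGal.baseFld p₁ φ₁ hφ₁))
      let U₁ : (PadicFrd.RelGal.baseFld p₁ φ₁ hφ₁)ˣ := Units.mk0 _ hϖ₁.ne_zero
      obtain ⟨π₂, hπ₂, hψ₀U⟩ := hπ₀ U₁ hϖ₁
      -- `ψ̄♮ (π₁) = π₂⁻¹`
      let y : (AlgebraicClosure (PadicFrd.RelGal.baseFld p₁ φ₁ hφ₁))ˣ :=
        Units.map (algebraMap (PadicFrd.RelGal.baseFld p₁ φ₁ hφ₁) (AlgebraicClosure (PadicFrd.RelGal.baseFld p₁ φ₁ hφ₁)) :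
          PadicFrd.RelGal.baseFld p₁ φ₁ hφ₁ →* AlgebraicClosure (PadicFrd.RelGal.baseFld p₁ φ₁ hφ₁)) U₁
      have hy : ψn y = (Units.map (algebraMap (PadicFrd.RelGal.baseFld p₂ φ₂ hφ₂)
          (AlgebraicClosure (PadicFrd.RelGal.baseFld p₂ φ₂ hφ₂)) : _ →* _) π₂)⁻¹ := by
        rw [h y, hψ₀U]
      -- the element `V₁ = ι₁(π₁) = π₁ ∈ ℚ̄_{p₁}` is a `p₁`-adic integer
      let V₁ : (Fbar ℚ_[p₁])ˣ := Units.map ((PadicFrd.RelGal.closureEquiv p₁ φ₁ hφ₁ :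
        AlgebraicClosure (PadicFrd.RelGal.baseFld p₁ φ₁ hφ₁) ≃ₐ[PadicFrd.RelGal.baseFld p₁ φ₁ hφ₁] Fbar ℚ_[p₁]) :
          AlgebraicClosure (PadicFrd.RelGal.baseFld p₁ φ₁ hφ₁) →* Fbar ℚ_[p₁]) y
      have hV₁ : (V₁ : Fbar ℚ_[p₁]) = ((ϖ₁ : PadicFrd.RelGal.baseFld p₁ φ₁ hφ₁) : Fbar ℚ_[p₁]) := by
        change PadicFrd.RelGal.closureEquiv p₁ φ₁ hφ₁ (algebraMap (PadicFrd.RelGal.baseFld p₁ φ₁ hφ₁)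
          (AlgebraicClosure (PadicFrd.RelGal.baseFld p₁ φ₁ hφ₁)) ϖ₁) = _
        rw [AlgEquiv.commutes]
        rfl
      have hV₁int : ‖(show PadicAlgCl p₁ from (V₁ : Fbar ℚ_[p₁]))‖ ≤ 1 := by
        rw [hV₁]
        exact (hv₁ ϖ₁).mp hϖ₁.val_lt_one.le
      -- hence so is `ψ̄ V₁ = ι₂ (ψ̄♮ π₁) = π₂⁻¹`
      have h2 := hint V₁ hV₁int
      have hval : ((ψbar V₁ : (Fbar ℚ_[p₂])ˣ) : Fbar ℚ_[p₂]) =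
          (((π₂⁻¹ : (PadicFrd.RelGal.baseFld p₂ φ₂ hφ₂)ˣ) : PadicFrd.RelGal.baseFld p₂ φ₂ hφ₂) : Fbar ℚ_[p₂]) := by
        have h3 := hψn y
        rw [hy] at h3
        have h4 := congrArg (PadicFrd.RelGal.closureEquiv p₂ φ₂ hφ₂) h3
        rw [AlgEquiv.apply_symm_apply] at h4
        rw [← h4, Units.val_inv_eq_inv_val, Units.coe_map, MonoidHom.coe_coe, map_inv₀, AlgEquiv.commutes,
          Units.val_inv_eq_inv_val]
        rfl
      have h5 : valuation (PadicFrd.RelGal.baseFld p₂ φ₂ hφ₂) (((π₂⁻¹ : (PadicFrd.RelGal.baseFld p₂ φ₂ hφ₂)ˣ) :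
          PadicFrd.RelGal.baseFld p₂ φ₂ hφ₂)) ≤ 1 := by
        refine (hv₂ _).mpr ?_
        have h6 : ‖(show PadicAlgCl p₂ from ((ψbar V₁ : (Fbar ℚ_[p₂])ˣ) : Fbar ℚ_[p₂]))‖ ≤ 1 := h2
        rwa [hval] at h6
      rw [Units.val_inv_eq_inv_val, map_inv₀] at h5
      have h7 := hπ₂.val_lt_one
      have h8 : 0 < valuation (PadicFrd.RelGal.baseFld p₂ φ₂ hφ₂) (π₂ : PadicFrd.RelGal.baseFld p₂ φ₂ hφ₂) :=
        zero_lt_iff.mpr ((Valuation.ne_zero_iff _).mpr π₂.ne_zero)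
      have h9 := one_lt_inv_iff₀.mpr ⟨h8, h7⟩
      exact absurd h5 (not_le.mpr h9)
  refine ⟨α, ψn, hα, hψn, heq, hu, ?_⟩
  rw [hψn_eq]
  exact hπ₀

end Chart

end BaseGaloisSystem

end Literature.AlgebraicGeometry.Frobenioids

end
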